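import Summits.QuantumFields.YangMills.Theorems.BalabanUVNodesN15KingModelPotentialLogDetLimit
import Summits.QuantumFields.YangMills.Theorems.BalabanUVNodesN15KingModelPotentialLogDetDensityRate
import Mathlib.Analysis.Calculus.UniformLimitsDeriv

/-!
# N15 (NE2) King-model rung, PART 45 — THE LIMIT FREE-ENERGY DENSITY IS DIFFERENTIABLE IN THE COUPLING AND ITS DERIVATIVE IS THE LIMIT RESPONSE:
# `d∕dt lim_k f_k(t) = Re e_∞(t) = lim_k f_k′(t)` (limit and derivative commute), for every volume

Eleventh generation (g11) of the seat `pub-ymgap-dag-n15-d`, part 45 (on 43 `…PotentialLogDetLimit`, 44 `…PotentialLogDetDensityRate`, 41; Mathlib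
`hasDerivAt_of_tendstoLocallyUniformlyOn`).  The three ingredients of the uniform-limit theorem for derivatives are in the tree: (i) `f_{k+1}′(t) = Re e_{k+1}(t)`
(41, Jacobi), (ii) `f_{k+1}(t) → f_∞(t)` for `|t| ≤ 1` (44), (iii) `e_{k+1} → e_∞` LOCALLY UNIFORMLY on the complex ball `‖z‖ < R′` (43, Vitali) — restricted to
the real segment `|t| < R′` through the embedding `ℝ → ℂ` and the uniformly continuous `Re`.  Hence, on King-admissible tori in 10e's window (`w₀ ≤ min(w̄, r_K)∕2`):

* `tendstoLocallyUniformlyOn_re_logDetResponseC` — `t ↦ Re e_{k+1}(t) → t ↦ Re e_∞(t)` locally uniformly on `(−R′, R′)`;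
* ★★★ `hasDerivAt_logDetDensity_lim` — for every `|t| < R′`: `HasDerivAt (t ↦ lim_k f_{k+1}(t)) (Re e_∞(t)) t`, where
  `e_∞(t) = vitaliLim (k ↦ e_{k+1}) t = |Λ|⁻¹·tr(C^{(∞)}_t·∂_tΔ^{(∞)}_{t·v})` (43) — THE DERIVATIVE OF THE CONTINUUM-LIMIT GAUSSIAN FREE ENERGY PER SITE IS THE
  CONTINUUM-LIMIT RESPONSE; and `Im e_∞(t) = 0`.

References (method): uniform limits of derivatives [folklore] (Mathlib); Jacobi (tree `LogDetDerivative`); Vitali (28c); King §4 pp.675–676 (A = 0 template).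

HONEST SCOPE.  King's A = 0 SCALAR model on the King-admissible tori (odd `L ≥ 3`, `a, m² > 0`), fixed volume (the convergence in `k` is at fixed `e`; the
RATES of 42∕44 are volume-uniform, this file's statement is pointwise in the volume); the Gaussian free energy per site — not the interacting vacuum energy,
not Bałaban's `E`, not King's `Z_k`; NOT a node discharge; count-neutral.  No `sorry`, standard axioms.
-/

noncomputable section

open scoped BigOperators Matrix
open Filter Topology Metric Finset Set

namespace Summit.QuantumFields.YangMills.BalabanUVNodes.N15.KingModel

open Literature.MathematicalPhysics.QuantumFieldTheory.Balaban1983to89 hiding blockOf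
open Literature.MathematicalPhysics.QuantumFieldTheory.Balaban1983to89.B5Prop11Plancherel (Tor fine)
open Literature.MathematicalPhysics.QuantumFieldTheory.King1986.Torus (gam0L gam0L_pos)
open Summit.QuantumFields.YangMills.BalabanUVNodes.N15KingModelRung.Curved (underPtN)

variable {d : ℕ}

section KingU

variable (L : ℕ) [NeZero L]

/-- The real segment `(−R′, R′)` embeds into the complex ball `‖z‖ < R′`. [folklore] -/
theorem mapsTo_ofReal_Ioo_ball (R' : ℝ) : MapsTo (fun t : ℝ => (t : ℂ)) (Ioo (-R') R') (ball (0 : ℂ) R') := by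
  intro t ht
  rw [mem_ball_zero_iff, Complex.norm_real, Real.norm_eq_abs]
  exact abs_lt.2 ⟨ht.1, ht.2⟩

/-- ★★★ **THE LIMIT FREE-ENERGY DENSITY IS DIFFERENTIABLE IN THE COUPLING WITH DERIVATIVE THE LIMIT RESPONSE.**  For odd `L ≥ 3`, `a, m² > 0` there is `w₁ > 0`
such that for every volume exponent `e`, every potential tower `v` with `sup|v_N| ≤ w₀ ≤ w₁`, `w₀ > 0`, coherence defect `≤ ν₀s^k` (`0 ≤ ν₀ ≤ w₁`, `0 ≤ s ≤ L^{−1∕2}`),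
every `0 < r < 1` and margin `0 < ρ₀ < R₂ := (r∕(1+r))·min(r_K∕w₀, 1)`, writing `R′ := R₂ − ρ₀`, `f_{k+1}(t) = logDetDensity (k+1) (v_{L^{k+1}}) t`,
`eS k z = e_{k+1}(z)`: for every real `t` with `|t| < R′`,
(i) `t′ ↦ Re e_{k+1}(t′)` converges to `t′ ↦ Re (vitaliLim eS t′)` locally uniformly on `(−R′, R′)`;
(ii) `HasDerivAt (t′ ↦ lim_k f_{k+1}(t′)) (Re (vitaliLim eS t)) t`;  (iii) `Im (vitaliLim eS t) = 0`
(41 `hasDerivAt_logDetDensity`, 44 `logDetDensity_limit`, 43 `logDetResponse_limit_holomorphic`, Mathlib `hasDerivAt_of_tendstoLocallyUniformlyOn`).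
[cite: King1986, §4 pp.675–676, (4.32) p.674 (A = 0 template); AlbergoEtAl2021Fermions, App. C (Jacobi, the tree's port)] -/
theorem hasDerivAt_logDetDensity_lim (hLodd : Odd L) (hL : 2 ≤ L) {a m2 : ℝ} (ha : 0 < a) (hm : 0 < m2) :
    ∃ w₁ : ℝ, 0 < w₁ ∧
      ∀ (e : ℕ) (v : ∀ N : ℕ, Tor (fine N (kingU d L e)) → ℝ) (w₀ ν₀ s : ℝ),
      0 ≤ ν₀ → ν₀ ≤ w₁ → 0 ≤ s → s ≤ (L : ℝ) ^ (-(1 / 2 : ℝ)) →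
      0 < w₀ → (∀ (N : ℕ) (x : Tor (fine N (kingU d L e))), |v N x| ≤ w₀) → w₀ ≤ w₁ →
      (∀ (k : ℕ), 1 ≤ k → ∀ x' : Tor (fine (L ^ 1 * L ^ k) (kingU d L e)),
          |v (L ^ 1 * L ^ k) x' - v (L ^ k) (underPtN L k 1 (kingU d L e) x')| ≤ ν₀ * s ^ k) →
      ∀ (r : ℝ), 0 < r → r < 1 → ∀ (ρ₀ : ℝ), 0 < ρ₀ → ρ₀ < r / (1 + r) * min (cplxWindow d a m2 L / w₀) 1 →
        let eS : ℕ → ℂ → ℂ := fun k z => logDetResponseC d a m2 L (kingM d L e) (k + 1) (v (L ^ (k + 1))) z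
        let fS : ℝ → ℕ → ℝ := fun t k => logDetDensity a m2 L (kingM d L e) (k + 1) (v (L ^ (k + 1))) t
        let R' : ℝ := r / (1 + r) * min (cplxWindow d a m2 L / w₀) 1 - ρ₀
        TendstoLocallyUniformlyOn (fun k (t : ℝ) => (eS k (t : ℂ)).re) (fun t : ℝ => (vitaliLim eS (t : ℂ)).re) atTop (Ioo (-R') R') ∧
        ∀ t : ℝ, |t| < R' →
          HasDerivAt (fun t' : ℝ => limUnder atTop (fS t')) ((vitaliLim eS (t : ℂ)).re) t ∧ (vitaliLim eS (t : ℂ)).im = 0 := by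
  obtain ⟨w₁, hw₁, H43⟩ := logDetResponse_limit_holomorphic (d := d) L hLodd hL ha hm
  obtain ⟨w₂, A, hw₂, hA, H44⟩ := logDetDensity_limit (d := d) L hLodd hL ha hm
  have hwb := (dressedConsts_nonneg (d := d) (a := a) (L := L) ha hL).2.2
  have hwin := cplxWindow_pos (d := d) (a := a) (m2 := m2) (L := L) ha hm hL
  refine ⟨min (min w₁ w₂) (min (wbarK (d + 1) a L) (cplxWindow d a m2 L)), lt_min (lt_min hw₁ hw₂) (lt_min hwb hwin), ?_⟩
  intro e v w₀ ν₀ s hν₀ hν₁ hs0 hs1 hw₀ hv hw₁' hcoh r hr0 hr1 ρ₀ hρ₀ hρR eS fS R'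
  have hν1 : ν₀ ≤ w₁ := hν₁.trans ((min_le_left _ _).trans (min_le_left _ _))
  have hν2 : ν₀ ≤ w₂ := hν₁.trans ((min_le_left _ _).trans (min_le_right _ _))
  have hwa : w₀ ≤ w₁ := hw₁'.trans ((min_le_left _ _).trans (min_le_left _ _))
  have hwc : w₀ ≤ w₂ := hw₁'.trans ((min_le_left _ _).trans (min_le_right _ _))
  have hwbar : w₀ ≤ wbarK (d + 1) a L := hw₁'.trans ((min_le_right _ _).trans (min_le_left _ _))
  have hwK : w₀ ≤ cplxWindow d a m2 L := hw₁'.trans ((min_le_right _ _).trans (min_le_right _ _))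
  obtain ⟨hrad1, -⟩ := disc_radius_le (d := d) (a := a) (m2 := m2) L hr0 hw₀ hwin
  have hR'1 : R' < 1 := by
    show r / (1 + r) * min (cplxWindow d a m2 L / w₀) 1 - ρ₀ < 1
    linarith [hrad1.trans (min_le_right _ _)]
  -- (i) local uniform convergence of the real parts along the real segment
  obtain ⟨-, hloc, -, -⟩ := H43 e v w₀ ν₀ s hν₀ hν1 hs0 hs1 hw₀ hv hwa hcoh r hr0 hr1 ρ₀ hρ₀ hρR
  have hre : TendstoLocallyUniformlyOn (fun k (t : ℝ) => (eS k (t : ℂ)).re) (fun t : ℝ => (vitaliLim eS (t : ℂ)).re) atTop (Ioo (-R') R') := by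
    have h1 := hloc.comp (fun t : ℝ => (t : ℂ)) (mapsTo_ofReal_Ioo_ball R') Complex.continuous_ofReal.continuousOn
    exact Complex.uniformContinuous_re.comp_tendstoLocallyUniformlyOn h1
  refine ⟨hre, fun t ht => ?_⟩
  -- (ii) the uniform-limit theorem for derivatives on the open segment
  have hopen : IsOpen (Ioo (-R') R') := isOpen_Ioo
  have hmem : t ∈ Ioo (-R') R' := ⟨(abs_lt.1 ht).1, (abs_lt.1 ht).2⟩
  have hderiv : ∀ k, ∀ t' ∈ Ioo (-R') R', HasDerivAt (fun t'' : ℝ => fS t'' k) ((eS k (t' : ℂ)).re) t' := by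
    intro k t' ht'
    have ht'1 : |t'| < 1 := lt_of_lt_of_le (abs_lt.2 ⟨ht'.1, ht'.2⟩) hR'1.le
    have hk1 : 1 ≤ k + 1 := Nat.succ_le_succ (Nat.zero_le k)
    have htw : |t'| * w₀ < wbarK (d + 1) a L := by
      calc |t'| * w₀ < 1 * w₀ := mul_lt_mul_of_pos_right ht'1 hw₀
        _ = w₀ := one_mul _
        _ ≤ wbarK (d + 1) a L := hwbar
    have htc : |t'| * w₀ ≤ cplxWindow d a m2 L := by
      calc |t'| * w₀ ≤ 1 * w₀ := mul_le_mul_of_nonneg_right ht'1.le hw₀.le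
        _ = w₀ := one_mul _
        _ ≤ cplxWindow d a m2 L := hwK
    obtain ⟨hD, hid⟩ := hasDerivAt_logDetDensity (M := kingM d L e) ha hm hL hk1 hw₀.le (hv (L ^ (k + 1))) htw htc
    have hval : (eS k (t' : ℂ)).re
        = ((Fintype.card (Tor (kingU d L e)) : ℝ))⁻¹ *
          ((kingLevelPot a m2 L (kingM d L e) (k + 1) (t' • v (L ^ (k + 1))) + kingBlock a L (kingM d L e))⁻¹
            * dLevel a m2 L (kingM d L e) (k + 1) (v (L ^ (k + 1))) t').trace := by
      show (logDetResponseC d a m2 L (kingM d L e) (k + 1) (v (L ^ (k + 1))) (t' : ℂ)).re = _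
      rw [hid, Complex.ofReal_re]
    rw [hval]
    exact hD
  have hlim : ∀ t' ∈ Ioo (-R') R', Tendsto (fun k => fS t' k) atTop (𝓝 (limUnder atTop (fS t'))) := by
    intro t' ht'
    have ht'1 : |t'| ≤ 1 := (lt_of_lt_of_le (abs_lt.2 ⟨ht'.1, ht'.2⟩) hR'1.le).le
    exact (H44 e v w₀ ν₀ s hν₀ hν2 hs0 hs1 hv hwc hcoh t' ht'1).1
  have hD := hasDerivAt_of_tendstoLocallyUniformlyOn hopen hre (Eventually.of_forall hderiv) hlim hmem
  refine ⟨hD, ?_⟩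
  -- (iii) the limit response is real at a real coupling
  have hptw : Tendsto (fun k => eS k (t : ℂ)) atTop (𝓝 (vitaliLim eS (t : ℂ))) :=
    hloc.tendsto_at (mapsTo_ofReal_Ioo_ball R' hmem)
  have him : ∀ k, (eS k (t : ℂ)).im = 0 := by
    intro k
    have ht1 : |t| < 1 := lt_of_lt_of_le ht hR'1.le
    have hk1 : 1 ≤ k + 1 := Nat.succ_le_succ (Nat.zero_le k)
    have htw : |t| * w₀ < wbarK (d + 1) a L := by
      calc |t| * w₀ < 1 * w₀ := mul_lt_mul_of_pos_right ht1 hw₀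
        _ = w₀ := one_mul _
        _ ≤ wbarK (d + 1) a L := hwbar
    have htc : |t| * w₀ ≤ cplxWindow d a m2 L := by
      calc |t| * w₀ ≤ 1 * w₀ := mul_le_mul_of_nonneg_right ht1.le hw₀.le
        _ = w₀ := one_mul _
        _ ≤ cplxWindow d a m2 L := hwK
    obtain ⟨-, hid⟩ := hasDerivAt_logDetDensity (M := kingM d L e) ha hm hL hk1 hw₀.le (hv (L ^ (k + 1))) htw htc
    show (logDetResponseC d a m2 L (kingM d L e) (k + 1) (v (L ^ (k + 1))) (t : ℂ)).im = 0
    rw [hid, Complex.ofReal_im]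
  have h1 : Tendsto (fun k => (eS k (t : ℂ)).im) atTop (𝓝 (vitaliLim eS (t : ℂ)).im) := (Complex.continuous_im.tendsto _).comp hptw
  have h2 : Tendsto (fun k => (eS k (t : ℂ)).im) atTop (𝓝 0) := by simp only [him]; exact tendsto_const_nhds
  exact tendsto_nhds_unique h1 h2

end KingU

end Summit.QuantumFields.YangMills.BalabanUVNodes.N15.KingModel

end
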